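import Literature.Computability.QuantumComplexity.InfluenceBounds
import Literature.Computability.QuantumComplexity.AddressFunctionQuery
import Mathlib.Analysis.SpecialFunctions.Pow.Real
import HarnessLib

/-!
# Route `SosSandwich`, crux `PseudoBoundedAA` (stmt-QuantumAdvantage-15237): `Σ_i √Inf_i` is EXPONENTIAL in the degree —
# the address function calibrates `sum_sqrt_influence_le`

`Theorems/SosSandwichPseudoBoundedAAVarianceSquared.lean` proves `Σ_i √Inf_i[p] ≤ 2·3^d·d²` for every `[0,1]`-valued `p`
of degree `≤ d` (step 2 of the level-free chain to `maxInf ≥ 4Var²/(9^d d⁴)`), the only step of that chain with an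
exponential loss.  This file shows the exponential is GENUINE for that inequality: the address function on `m + 2^m`
bits (tree `Literature.Computability.QuantumComplexity.AddressFunction.addrFn`, de Wolf 2008 §4.4; value = the table bit
addressed by the first `m` bits) is `{0,1}`-valued of degree `≤ m + 1`, each of its `2^m` table bits has influence exactly
`2^{-m}` (`influence_table`), so `Σ_i √Inf_i ≥ 2^m · 2^{-m/2} = 2^{m/2}` (`two_pow_le_sq_sum_sqrt_influence`:
`2^m ≤ (Σ_i √Inf_i)²`), against the upper bound `2·3^{m+1}(m+1)²`: no bound `Σ_i √Inf_i ≤ poly(d)` holds, the base of the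
exponential lies in `[√2, 3]` (`exists_sqrt_influence_sum_exponential`).  Caveat recorded for the crux: the address bits have
influence `1/2`, so this witness says nothing about the small-max-influence regime (the Aaronson–Ambainis regime); it
calibrates the INEQUALITY, not the conjecture.

* §1 `sq_sub_flipBit_table` — for cube values of the address function, flipping table bit `t` changes the value iff
  `addr x = t`: `(p(x) - p(x^{⊕ t}))² = [addr x = t]`.
* §2 `sum_ite_addr_eq`, `boolAvg_ite_addr` — each address class has `2^{2^m}` members: `E_x [addr x = t] = 2^{-m}`
  (re-index the cube by `Fin.appendEquiv`; the digit map `(Fin m → Bool) ≃ Fin (2^m)`).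
* §3 `influence_table`, `two_pow_le_sq_sum_sqrt_influence`.
* §4 `exists_addrPoly` — a real polynomial of total degree `≤ m + 1` with the address function as cube values
  (`Σ_t (Π_j ℓ_{t,j}) · y_t`, `ℓ_{t,j} ∈ {x_j, 1 - x_j}` by the digits of `t`); `exists_sqrt_influence_sum_exponential`.

Honest label: calibration lemma (tightness of a support inequality); no stub, crux or summit is proved.
Sources: de Wolf 2008 §4.4 (address function); Nisan–Szegedy 1994; O'Donnell 2014 §2.2.
-/

-- D-0017: single-conjunct summit ⇒ the duplicate `QuantumAdvantage.QuantumAdvantage` is mandated.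
set_option linter.dupNamespace false

noncomputable section

namespace Summit.QuantumAdvantage.QuantumAdvantage.Theorems.SosSandwich.SqrtInfluenceAddress

open Finset
open Literature.Computability.QuantumComplexity
open Literature.Computability.QuantumComplexity.AddressFunction (addr digits addr_flipBit_natAdd)

variable {m : ℕ}

/-! ### §1 Flipping a table bit -/

/-- Table positions are injective in the table index. [folklore] -/
theorem natAdd_ne_natAdd {s t : Fin (2 ^ m)} (h : s ≠ t) : Fin.natAdd m s ≠ Fin.natAdd m t := by
  intro e
  apply h
  ext
  have := congrArg Fin.val e
  simpa [Fin.val_natAdd] using this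

/-- **Flipping table bit `t` changes the address function iff `t` is the address**: for a polynomial with the address
function's cube values, `(p(x) - p(x^{⊕t}))² = [addr x = t]`. [cite: DeWolf2008, §4.4 p. 10] -/
theorem sq_sub_flipBit_table {p : MvPolynomial (Fin (m + 2 ^ m)) ℝ}
    (hp : ∀ x, evalBool p x = if x (Fin.natAdd m (addr x)) then 1 else 0) (t : Fin (2 ^ m))
    (x : Fin (m + 2 ^ m) → Bool) :
    (evalBool p x - evalBool p (flipBit (Fin.natAdd m t) x)) ^ 2 = if addr x = t then 1 else 0 := by
  rw [hp, hp, addr_flipBit_natAdd]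
  by_cases h : addr x = t
  · rw [if_pos h, h]
    have hflip : flipBit (Fin.natAdd m t) x (Fin.natAdd m t) = !x (Fin.natAdd m t) := by simp [flipBit]
    rw [hflip]
    cases x (Fin.natAdd m t) <;> norm_num
  · rw [if_neg h]
    have hne : Fin.natAdd m (addr x) ≠ Fin.natAdd m t := natAdd_ne_natAdd h
    rw [flipBit, Function.update_of_ne hne]
    ring

/-! ### §2 Each address class has `2^{2^m}` members -/

/-- The address of an appended input `(a, y)` is the number with binary digits `a`. [cite: DeWolf2008, §4.4 p. 10] -/
theorem addr_append (a : Fin m → Bool) (y : Fin (2 ^ m) → Bool) :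
    addr (Fin.append a y) = finFunctionFinEquiv (fun j => if a j = true then (1 : Fin 2) else 0) := by
  unfold addr digits
  congr 1
  funext j
  rw [Fin.append_left]

/-- The digit map `(Fin m → Bool) → Fin (2^m)` is a bijection: exactly one digit string has a given value. [folklore] -/
theorem sum_ite_digits_eq_one (t : Fin (2 ^ m)) :
    ∑ a : Fin m → Bool,
      (if finFunctionFinEquiv (fun j => if a j = true then (1 : Fin 2) else 0) = t then (1 : ℝ) else 0) = 1 := by
  set E : (Fin m → Bool) ≃ Fin (2 ^ m) :=
    (Equiv.piCongrRight fun _ : Fin m => finTwoEquiv.symm).trans finFunctionFinEquiv with hE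
  have hEa : ∀ a : Fin m → Bool,
      E a = finFunctionFinEquiv (fun j => if a j = true then (1 : Fin 2) else 0) := fun a => by
    show finFunctionFinEquiv (fun j => finTwoEquiv.symm (a j)) = _
    congr 1
    funext j
    cases a j <;> rfl
  calc ∑ a : Fin m → Bool,
        (if finFunctionFinEquiv (fun j => if a j = true then (1 : Fin 2) else 0) = t then (1 : ℝ) else 0)
      = ∑ a : Fin m → Bool, (if E a = t then (1 : ℝ) else 0) :=
        Finset.sum_congr rfl fun a _ => by rw [hEa]
    _ = ∑ s : Fin (2 ^ m), (if s = t then (1 : ℝ) else 0) := E.sum_comp (fun s => if s = t then (1 : ℝ) else 0)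
    _ = 1 := by rw [Finset.sum_ite_eq' Finset.univ t, if_pos (Finset.mem_univ t)]

/-- **`#{x : addr x = t} = 2^{2^m}`** (re-index the cube `{0,1}^{m + 2^m}` by address digits and table).
[cite: DeWolf2008, §4.4 p. 10] -/
theorem sum_ite_addr_eq (t : Fin (2 ^ m)) :
    ∑ x : Fin (m + 2 ^ m) → Bool, (if addr x = t then (1 : ℝ) else 0) = (2 : ℝ) ^ (2 ^ m) := by
  rw [← (Fin.appendEquiv m (2 ^ m)).sum_comp (fun x => if addr x = t then (1 : ℝ) else 0)]
  change ∑ q : (Fin m → Bool) × (Fin (2 ^ m) → Bool),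
      (if addr (Fin.append q.1 q.2) = t then (1 : ℝ) else 0) = _
  rw [Fintype.sum_prod_type]
  simp only [addr_append]
  have hy : ∀ a : Fin m → Bool, ∑ _y : Fin (2 ^ m) → Bool,
      (if finFunctionFinEquiv (fun j => if a j = true then (1 : Fin 2) else 0) = t then (1 : ℝ) else 0) =
      (2 : ℝ) ^ (2 ^ m) *
        (if finFunctionFinEquiv (fun j => if a j = true then (1 : Fin 2) else 0) = t then (1 : ℝ) else 0) := by
    intro a
    simp [Finset.card_univ, Fintype.card_fin]
  simp_rw [hy]
  rw [← Finset.mul_sum, sum_ite_digits_eq_one, mul_one]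

/-- **`E_x [addr x = t] = 2^{-m}`**. [cite: DeWolf2008, §4.4 p. 10] -/
theorem boolAvg_ite_addr (t : Fin (2 ^ m)) :
    boolAvg (fun x : Fin (m + 2 ^ m) → Bool => if addr x = t then (1 : ℝ) else 0) = 1 / (2 : ℝ) ^ m := by
  unfold boolAvg
  rw [sum_ite_addr_eq, pow_add]
  field_simp

/-! ### §3 Table influences and the exponential lower bound on `Σ_i √Inf_i` -/

/-- **Each table bit of the address function has influence exactly `2^{-m}`** (`Inf = E (p - p^{⊕t})² = Pr[addr = t]`).
[cite: DeWolf2008, §4.4 p. 10] [cite: ODonnell2014, §2.2] -/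
theorem influence_table {p : MvPolynomial (Fin (m + 2 ^ m)) ℝ}
    (hp : ∀ x, evalBool p x = if x (Fin.natAdd m (addr x)) then 1 else 0) (t : Fin (2 ^ m)) :
    influence (Fin.natAdd m t) p = 1 / (2 : ℝ) ^ m := by
  unfold influence
  have h : (fun x => (evalBool p x - evalBool p (flipBit (Fin.natAdd m t) x)) ^ 2) =
      fun x => if addr x = t then (1 : ℝ) else 0 := funext fun x => sq_sub_flipBit_table hp t x
  rw [h, boolAvg_ite_addr]

/-- **`2^m ≤ (Σ_i √Inf_i[p])²`** for the address function on `m + 2^m` bits (the `2^m` table bits alone contribute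
`2^m · 2^{-m/2} = 2^{m/2}` to `Σ_i √Inf_i`). [cite: DeWolf2008, §4.4 p. 10] [cite: ODonnell2014, §2.2] -/
theorem two_pow_le_sq_sum_sqrt_influence {p : MvPolynomial (Fin (m + 2 ^ m)) ℝ}
    (hp : ∀ x, evalBool p x = if x (Fin.natAdd m (addr x)) then 1 else 0) :
    (2 : ℝ) ^ m ≤ (∑ i, Real.sqrt (influence i p)) ^ 2 := by
  rw [Fin.sum_univ_add]
  simp_rw [influence_table hp]
  have h1 : 0 ≤ ∑ i : Fin m, Real.sqrt (influence (Fin.castAdd (2 ^ m) i) p) :=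
    Finset.sum_nonneg fun i _ => Real.sqrt_nonneg _
  have h2 : ∑ _i : Fin (2 ^ m), Real.sqrt (1 / (2 : ℝ) ^ m) = (2 : ℝ) ^ m * Real.sqrt (1 / (2 : ℝ) ^ m) := by
    simp [Finset.card_univ, Fintype.card_fin]
  rw [h2]
  have hs : ((2 : ℝ) ^ m * Real.sqrt (1 / (2 : ℝ) ^ m)) ^ 2 = (2 : ℝ) ^ m := by
    rw [mul_pow, Real.sq_sqrt (by positivity)]
    field_simp
  have h0 : 0 ≤ (2 : ℝ) ^ m * Real.sqrt (1 / (2 : ℝ) ^ m) := by positivity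
  calc (2 : ℝ) ^ m = ((2 : ℝ) ^ m * Real.sqrt (1 / (2 : ℝ) ^ m)) ^ 2 := hs.symm
    _ ≤ (∑ i : Fin m, Real.sqrt (influence (Fin.castAdd (2 ^ m) i) p) +
          (2 : ℝ) ^ m * Real.sqrt (1 / (2 : ℝ) ^ m)) ^ 2 := by
        apply pow_le_pow_left₀ h0
        linarith

/-! ### §4 The address function is a polynomial of degree `≤ m + 1`; the calibration -/

/-- Digit strings and addresses: `x`'s address is `t` iff its address bits are the binary digits of `t`. [folklore] -/
theorem addr_eq_iff (x : Fin (m + 2 ^ m) → Bool) (t : Fin (2 ^ m)) :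
    addr x = t ↔ ∀ j : Fin m, x (Fin.castAdd (2 ^ m) j) = decide ((finFunctionFinEquiv.symm t) j = 1) := by
  unfold addr
  rw [Equiv.apply_eq_iff_eq_symm_apply, funext_iff]
  refine forall_congr' fun j => ?_
  unfold digits
  generalize (finFunctionFinEquiv.symm t) j = s
  cases x (Fin.castAdd (2 ^ m) j) <;> fin_cases s <;> simp

/-- **The address function is a real polynomial of total degree `≤ m + 1` on the cube** ("it is represented by
`Σ_t (Π_j ℓ_{t,j}) y_t` and hence has degree `m + 1`"). [cite: DeWolf2008, §4.4 p. 10] -/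
theorem exists_addrPoly (m : ℕ) : ∃ p : MvPolynomial (Fin (m + 2 ^ m)) ℝ, p.totalDegree ≤ m + 1 ∧
    ∀ x, evalBool p x = if x (Fin.natAdd m (addr x)) then 1 else 0 := by
  classical
  -- the digit pattern of `t` and the literals `ℓ_{t,j} ∈ {x_j, 1 - x_j}`
  set dB : Fin (2 ^ m) → Fin m → Bool := fun t j => decide ((finFunctionFinEquiv.symm t) j = 1) with hdB
  set L : Fin (2 ^ m) → Fin m → MvPolynomial (Fin (m + 2 ^ m)) ℝ := fun t j =>
    if dB t j = true then MvPolynomial.X (Fin.castAdd (2 ^ m) j)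
    else 1 - MvPolynomial.X (Fin.castAdd (2 ^ m) j) with hL
  refine ⟨∑ t : Fin (2 ^ m), (∏ j : Fin m, L t j) * MvPolynomial.X (Fin.natAdd m t), ?_, ?_⟩
  · -- degree `≤ m + 1`
    refine (MvPolynomial.totalDegree_finsetSum _ _).trans (Finset.sup_le fun t _ => ?_)
    refine (MvPolynomial.totalDegree_mul _ _).trans ?_
    have hL1 : ∀ j, (L t j).totalDegree ≤ 1 := by
      intro j
      by_cases h : dB t j = true
      · have e : L t j = MvPolynomial.X (Fin.castAdd (2 ^ m) j) := by rw [hL]; exact if_pos h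
        rw [e, MvPolynomial.totalDegree_X]
      · have e : L t j = 1 - MvPolynomial.X (Fin.castAdd (2 ^ m) j) := by rw [hL]; exact if_neg h
        rw [e]
        refine (MvPolynomial.totalDegree_sub _ _).trans ?_
        rw [MvPolynomial.totalDegree_one, MvPolynomial.totalDegree_X]
        simp
    have hprod : (∏ j : Fin m, L t j).totalDegree ≤ m := by
      refine (MvPolynomial.totalDegree_finsetProd _ _).trans ?_
      calc ∑ j : Fin m, (L t j).totalDegree ≤ ∑ _j : Fin m, 1 := Finset.sum_le_sum fun j _ => hL1 j
        _ = m := by simp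
    have hX : (MvPolynomial.X (Fin.natAdd m t) : MvPolynomial (Fin (m + 2 ^ m)) ℝ).totalDegree = 1 :=
      MvPolynomial.totalDegree_X _
    rw [hX]
    omega
  · -- cube values
    intro x
    have hLev : ∀ t j, evalBool (L t j) x = if x (Fin.castAdd (2 ^ m) j) = dB t j then 1 else 0 := by
      intro t j
      unfold evalBool
      by_cases h : dB t j = true
      · have e : L t j = MvPolynomial.X (Fin.castAdd (2 ^ m) j) := by rw [hL]; exact if_pos h
        rw [e, MvPolynomial.eval_X, h]
      · have e : L t j = 1 - MvPolynomial.X (Fin.castAdd (2 ^ m) j) := by rw [hL]; exact if_neg h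
        rw [Bool.not_eq_true] at h
        rw [e, map_sub, map_one, MvPolynomial.eval_X, h]
        cases x (Fin.castAdd (2 ^ m) j) <;> simp
    have hprodev : ∀ t, evalBool (∏ j : Fin m, L t j) x = if addr x = t then 1 else 0 := by
      intro t
      have e1 : evalBool (∏ j : Fin m, L t j) x = ∏ j : Fin m, evalBool (L t j) x := by
        unfold evalBool; rw [map_prod]
      rw [e1]
      simp_rw [hLev]
      rw [Finset.prod_boole]
      have hiff : (∀ j ∈ (Finset.univ : Finset (Fin m)), x (Fin.castAdd (2 ^ m) j) = dB t j) ↔ addr x = t := by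
        rw [addr_eq_iff]
        simp [hdB]
      simp only [hiff]
    unfold evalBool
    rw [map_sum]
    have e2 : ∀ t, MvPolynomial.eval (fun i => if x i then (1 : ℝ) else 0)
        ((∏ j : Fin m, L t j) * MvPolynomial.X (Fin.natAdd m t)) =
        (if addr x = t then 1 else 0) * (if x (Fin.natAdd m t) then 1 else 0) := by
      intro t
      rw [map_mul, MvPolynomial.eval_X]
      have := hprodev t
      unfold evalBool at this
      rw [this]
    simp_rw [e2]
    simp_rw [ite_mul, one_mul, zero_mul]
    rw [Finset.sum_ite_eq Finset.univ (addr x), if_pos (Finset.mem_univ _)]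

/-- **`Σ_i √Inf_i` is exponential in the degree.**  For every `m` there is a `[0,1]`-valued (indeed `{0,1}`-valued)
real polynomial `p` on `m + 2^m` bits of total degree `≤ m + 1` with `2^m ≤ (Σ_i √Inf_i[p])²`, i.e.
`Σ_i √Inf_i[p] ≥ 2^{m/2}` — against `Σ_i √Inf_i ≤ 2·3^{m+1}(m+1)²` of `VarianceSquared.sum_sqrt_influence_le`: no
bound polynomial in the degree is possible for this quantity. (The witness has `m` address bits of influence `1/2`; it
does not concern the small-max-influence regime.) [cite: DeWolf2008, §4.4 p. 10] [cite: ODonnell2014, §2.2]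
[cite: AaronsonAmbainis2014, Conj. 6] -/
theorem exists_sqrt_influence_sum_exponential (m : ℕ) :
    ∃ p : MvPolynomial (Fin (m + 2 ^ m)) ℝ, p.totalDegree ≤ m + 1 ∧
      (∀ x, 0 ≤ evalBool p x ∧ evalBool p x ≤ 1) ∧ (2 : ℝ) ^ m ≤ (∑ i, Real.sqrt (influence i p)) ^ 2 := by
  obtain ⟨p, hdeg, hp⟩ := exists_addrPoly m
  refine ⟨p, hdeg, fun x => ?_, two_pow_le_sq_sum_sqrt_influence hp⟩
  rw [hp x]
  split_ifs <;> norm_num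

end Summit.QuantumAdvantage.QuantumAdvantage.Theorems.SosSandwich.SqrtInfluenceAddress

end
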